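import Summits.HodgeConjecture.HodgeConjecture.Theorems.K2LiuInertHeckeRecursion
import Summits.HodgeConjecture.HodgeConjecture.Theorems.K2LiuUnramifiedSectionOnCartanInert
import Summits.HodgeConjecture.HodgeConjecture.Theorems.K2LiuCartanSeriesU11Closed
import Summits.HodgeConjecture.HodgeConjecture.Theorems.K2LiuUnramifiedDoublingHeckeIdentity
import Literature.NumberTheory.Automorphic.AdicCompletionResidueCard
import Literature.NumberTheory.Automorphic.HeckeOperatorAdjoint
import Literature.NumberTheory.GaloisRepresentations.HeckeLFunctionNonvanishingLineProofs

/-!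
# The unramified doubling Hecke identity at an INERT good place, `n = 2` (socket #28i of hLiu418's LOCAL SEAM of s23 — the payer head)

Track B ∕ K2-LIT, hLiu418 = stmt-HodgeConjecture-24832; words `K2/K2Liu-p01/g3/INERT-SOCKETS-v2.K2Liup01g3.md` §1 (the statement below is that
§1 verbatim: #28s ED. 3 binders with the inert place, the hyperbolic frame `T`, the `σ_w`-fixed uniformizer `ϖ` and ONE generator `t₁`,
`(t₁)_w = T⁻¹·diag(ϖ, ϖ⁻¹)·T`; the typist's U5e socket `sig_K2LiuUnramifiedDoublingHeckeIdentityInert` is to be tied to it by name).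
ASSEMBLY (the inert twin of ★ #28s `K2LiuUnramifiedDoublingHeckeIdentity.unramifiedDoublingHeckeIdentity`): ★ p857060 `isCartanFamily_localInt_inert`
(`G_v = ⨆_m K_v t₁ᵐ K_v`), ★ #27i p857024 `lambdaLoc_iotaLeftLocPi_cartan_inert` (`Λ_{s,v}(ι_v(t₁ᵐ,1)) = θ^m q_v^{−2m(s+1)}`, `θ = χ(ϖ_w)`), ★ H3a
`K2LiuInertHeckeRecursion.heckeOperator_pow_apply_eq_smul_inert` (`[K_v t₁ᵐ K_v] u = μ_m u`, the `U(1,1)` recursion from the hyperspecial Hecke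
neighbours ★ H1∕H2) and `ncard_orbit_pow_inert` (volumes `(q_v+1)q_v(q_v²)^{m−1}`), ★ H1 `isDoublingHeckeEigenvector_cLoc_of_isOpen` (`T(Λ)u = (∑ Λ_m μ_m) u`),
absolute convergence on `Re s > 0` (one geometric cone, ratio `q_v^{−2 Re s}`), and the closed form ★ p857068 `cartanSeriesU11_closed_form`:
`c·(1 − θ(a₁−q+1)q^{−(2s+2)} + θ²q^{−(4s+2)}) = (1 + θq^{−(2s+1)})(1 − θq^{−(2s+2)})`, i.e. `c = L_w(s+½, BC(σ_v)⊗χ_w)·(1 − χ⁰ε q_v^{−(2s+1)})(1 − χ⁰q_v^{−(2s+2)})`.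
[Li1992, §3 Thm. 3.1]; [GelbartPiatetskishapiroRallis1987, Part A §6]; [Liu2011, §2C (2-4)]; [Macdonald1971, Ch. V §3]. Theorems only; no `sorry`.
HONEST LABEL: HC_CM is proved only modulo the printed citations (2 remaining named inputs: hLiu418 = stmt-HodgeConjecture-24832, h413 =
stmt-HodgeConjecture-24833) until rung 0 closes; this file pays one tier-1 socket (once tied) and moves no counter by itself.
-/

set_option autoImplicit false

set_option linter.dupNamespace false

noncomputable section

open scoped Matrix Pointwise Valued
open NumberField IsDedekindDomain Matrix MeasureTheory MulAction

namespace Summit.HodgeConjecture.HodgeConjecture.Cruxes.HLiu418.K2LiuUnramifiedDoublingHeckeIdentityInert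

open Literature.NumberTheory.Automorphic Literature.NumberTheory.Automorphic.UnitaryGroup Literature.NumberTheory.GaloisRepresentations
open Literature.NumberTheory.GelbartRogawski1991 Literature.NumberTheory.GelbartRogawski1991.GRConstruction
open Literature.NumberTheory.GelbartRogawski1991.UnitaryDualPair
open Literature.NumberTheory.K2Lit Literature.NumberTheory.K2Lit.SiegelDoubled
open Summit.HodgeConjecture.HodgeConjecture.Cruxes.HLiu418.K2LiuCartanFamilyInert
open Summit.HodgeConjecture.HodgeConjecture.Cruxes.HLiu418.K2LiuUnramifiedSectionOnCartan
open Summit.HodgeConjecture.HodgeConjecture.Cruxes.HLiu418.K2LiuUnramifiedSectionOnCartanInert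
open Summit.HodgeConjecture.HodgeConjecture.Cruxes.HLiu418.K2LiuDoublingHeckeCartanSum
open Summit.HodgeConjecture.HodgeConjecture.Cruxes.HLiu418.K2LiuCartanSeriesU11Closed
open Summit.HodgeConjecture.HodgeConjecture.Cruxes.HLiu418.K2LiuUnramifiedDoublingHeckePrelims
open Summit.HodgeConjecture.HodgeConjecture.Cruxes.HLiu418.K2LiuInertHeckeRecursion

set_option maxHeartbeats 1600000 in -- the adelic unitary datum (`localPi`, `localInt`, `LambdaLoc`, Cartan family), as for ★ #28s
/-- **THE UNRAMIFIED DOUBLING HECKE IDENTITY AT AN INERT GOOD PLACE, `n = 2`** — socket #28i (words v2 §1): at a place `v` of `L⁺` inert and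
unramified in `L`, with a `σ_w`-fixed uniformizer `ϖ`, an integral hyperbolic frame `T` of the place form and a Hecke generator `t₁`
(`(t₁)_w = T⁻¹·diag(ϖ, ϖ⁻¹)·T`), a non-zero `K_v`-spherical Hecke eigenvector `u` (`∫_{K_v t₁ K_v} τ = a₁` in the `ν(K_v) = 1` currency) of a contractive
strongly continuous Banach representation `τ` of `G_v = U(V)(L⁺_v)` is a doubling Hecke eigenvector of the kernel `Λ_{s,v}(ι_v(·,1))` (convergence on
`Re s > 0`) with eigenvalue `c`, and `c·(1 − θ(a₁−q_v+1)q_v^{−(2s+2)} + θ²q_v^{−(4s+2)}) = (1 + θq_v^{−(2s+1)})(1 − θq_v^{−(2s+2)})`, `θ = χ(ϖ_w)`.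
[cite: Li1992, §3 Thm. 3.1] [cite: GelbartPiatetskishapiroRallis1987, Part A §6] [cite: Liu2011, §2C (2-4) p. 863] [cite: Macdonald1971, Ch. V §3 (3.9)] -/
theorem unramifiedDoublingHeckeIdentityInert :
    ∀ (L : Type) [Field L] [NumberField L] [IsCMField L] {n : ℕ} (e : Fin 2 × Fin 1 ≃ Fin n)
      (dV : Fin 2 → L) (hdV : ∀ i, IsCMField.complexConj L (dV i) = dV i) (_hdV0 : ∀ i, dV i ≠ 0)
      (dW : Fin 1 → L) (hdW : ∀ i, IsCMField.complexConj L (dW i) = dW i) (_hdW0 : ∀ i, dW i ≠ 0)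
      (v : HeightOneSpectrum (𝓞 (Fp L)))
      -- an INERT UNRAMIFIED place of good reduction for `(V, χ)`
      (w : UnitaryGroup.PlacesOver L v) (_hw : IsCMField.complexConj L • w.1 = w.1) (_hv : Algebra.IsUnramifiedIn (𝓞 L) v.asIdeal)
      (_h2 : ∀ w' : UnitaryGroup.PlacesOver L v, ValuativeRel.valuation (w'.1.adicCompletion L) (2 : w'.1.adicCompletion L) = 1)
      (_hdVw : ∀ (w' : UnitaryGroup.PlacesOver L v) (i : Fin 2),
        ValuativeRel.valuation (w'.1.adicCompletion L) (algebraMap L (w'.1.adicCompletion L) (dV i)) = 1)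
      (_hT : ∀ (w' : UnitaryGroup.PlacesOver L v) (i j : Fin n), ValuativeRel.valuation (w'.1.adicCompletion L)
        (algebraMap L (w'.1.adicCompletion L) (algebraMap (Fp L) L (gramR L e dV hdV dW hdW i j))) ≤ 1)
      (_hTinv : ∀ (w' : UnitaryGroup.PlacesOver L v) (i j : Fin n), ValuativeRel.valuation (w'.1.adicCompletion L)
        (algebraMap L (w'.1.adicCompletion L) (algebraMap (Fp L) L ((gramR L e dV hdV dW hdW)⁻¹ i j))) ≤ 1)
      (χ : HeckeCharacter L) (_hχu : χ.IsUnitary) (_hχ : ∀ w' : UnitaryGroup.PlacesOver L v, χ.IsUnramifiedAt w'.1)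
      (s : ℂ) (_hs : 0 < s.re)
      -- Haar measure on `G_v = U(V)(L⁺_v)` normalised by `ν(K_v) = 1`
      [MeasurableSpace (UnitaryGroup.localPi L (IsCMField.complexConj L) 2 (Matrix.diagonal dV) v)]
      [BorelSpace (UnitaryGroup.localPi L (IsCMField.complexConj L) 2 (Matrix.diagonal dV) v)]
      (ν : Measure (UnitaryGroup.localPi L (IsCMField.complexConj L) 2 (Matrix.diagonal dV) v)) [ν.IsHaarMeasure]
      (_hνK : ν (UnitaryGroup.localInt L (IsCMField.complexConj L) 2 (Matrix.diagonal dV) v :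
          Set (UnitaryGroup.localPi L (IsCMField.complexConj L) 2 (Matrix.diagonal dV) v)) = 1)
      -- the inert frame: a `σ_w`-fixed uniformizer, an integral hyperbolic frame of the place form, and the Hecke generator
      (ϖ : w.1.adicCompletion L) (_hϖ : Valued.v ϖ = WithZero.exp (-1 : ℤ))
      (_hϖσ : galAdicCompletionMap (L := L) (IsCMField.complexConj L) _hw ϖ = ϖ)
      (T : GL (Fin 2) (w.1.adicCompletion L)) (_hTi : T ∈ glInt 2 (w.1.adicCompletion L))
      (_hTJ : UnitaryGroup.placeForm (Matrix.diagonal dV) w.1 =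
        formCongr (galAdicCompletionMap (L := L) (IsCMField.complexConj L) _hw) T ((StdForm.antidiagonal 2).over (w.1.adicCompletion L)))
      (t₁ : UnitaryGroup.localPi L (IsCMField.complexConj L) 2 (Matrix.diagonal dV) v)
      (_ht₁ : (((t₁ : UnitaryGroup.LocalGLPi L 2 v) w : GL (Fin 2) (w.1.adicCompletion L)) : Matrix (Fin 2) (Fin 2) (w.1.adicCompletion L)) =
        ((T⁻¹ : GL (Fin 2) (w.1.adicCompletion L)) : Matrix (Fin 2) (Fin 2) (w.1.adicCompletion L)) * Matrix.diagonal ![ϖ, ϖ⁻¹] *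
          (T : Matrix (Fin 2) (Fin 2) (w.1.adicCompletion L)))
      -- a contractive, strongly continuous Banach representation and a non-zero spherical Hecke eigenvector
      {V : Type} [NormedAddCommGroup V] [NormedSpace ℂ V] [CompleteSpace V]
      (τ : UnitaryGroup.localPi L (IsCMField.complexConj L) 2 (Matrix.diagonal dV) v →* (V →L[ℂ] V))
      (_hτc : ∀ x : V, Continuous fun g => τ g x) (_hτb : ∀ g, ‖τ g‖ ≤ 1)
      (u : V) (_hu : u ≠ 0) (a₁ : ℂ)
      (_heig : IsSphericalHeckeEigen ν (UnitaryGroup.localInt L (IsCMField.complexConj L) 2 (Matrix.diagonal dV) v) ![t₁] (fun g => τ g) u ![a₁]),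
      ∃ c : ℂ,
        IsDoublingHeckeEigenvector ν (fun g => LambdaLoc L e dV hdV dW hdW v χ s (iotaLeftLocPi L e dV hdV dW hdW v g)) (fun g => τ g) u c ∧
        c * (1 - χ.valueAtUniformizer w.1 * (a₁ - (v.residueCard : ℂ) + 1) * (v.residueCard : ℂ) ^ (-(2 * s + 2)) +
              χ.valueAtUniformizer w.1 ^ 2 * (v.residueCard : ℂ) ^ (-(4 * s + 2))) =
          (1 + χ.valueAtUniformizer w.1 * (v.residueCard : ℂ) ^ (-(2 * s + 1))) *
            (1 - χ.valueAtUniformizer w.1 * (v.residueCard : ℂ) ^ (-(2 * s + 2))) := by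
  intro L _ _ _ n e dV hdV hdV0 dW hdW hdW0 v w hw hv h2 hdVw hT hTinv χ hχu hχ s hs _ _ ν _ hνK ϖ hϖ hϖσ T hTi hTJ t₁ ht₁ V _ _ _ τ hτc hτb u hu
    a₁ heig
  classical
  haveI : Algebra.IsQuadraticExtension (Fp L) L := IsCMField.isQuadraticExtension L
  set Kv := UnitaryGroup.localInt L (IsCMField.complexConj L) 2 (Matrix.diagonal dV) v with hKvdef
  /- ### the place data: `q = q_v`, `N(w) = q²`, `‖ϖ‖ = q⁻²` -/
  set q : ℕ := v.residueCard with hqdef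
  have hq1 : 1 < q := by
    rw [hqdef, HeightOneSpectrum.residueCard_eq_card_quotient]
    haveI : Finite (𝓞 (Fp L) ⧸ v.asIdeal) := Ideal.finiteQuotientOfFreeOfNeBot v.asIdeal v.ne_bot
    haveI : v.asIdeal.IsPrime := v.isPrime
    haveI : IsDomain (𝓞 (Fp L) ⧸ v.asIdeal) := Ideal.Quotient.isDomain v.asIdeal
    exact Finite.one_lt_card
  have hq0 : (q : ℂ) ≠ 0 := Nat.cast_ne_zero.2 (by omega)
  have hqpos : 0 < q := by omega
  have hq1r : (1 : ℝ) < q := by exact_mod_cast hq1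
  have hQ : w.1.residueCard = q ^ 2 := by
    have h1 : Nat.card 𝓀[w.1.adicCompletion L] = w.1.residueCard := by
      rw [HeightOneSpectrum.residueCard_eq_card_quotient]
      exact IsDedekindDomain.HeightOneSpectrum.natCard_residueField_adicCompletion L w.1
    rw [← h1, natCard_residueField_eq_sq_inert L v w hw hv]
  have hnu : ‖(HeckeCharacter.uniformizer L w.1 : w.1.adicCompletion L)‖ = ((w.1.residueCard : ℝ))⁻¹ := HeckeCharacter.norm_uniformizer w.1
  have hnormϖ : ‖ϖ‖ = ((q ^ 2 : ℕ) : ℝ)⁻¹ := by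
    rw [← hQ, ← hnu, NumberField.FinitePlace.norm_def, NumberField.FinitePlace.norm_def, hϖ,
      HeckeCharacter.valued_uniformizer (K := L) (v := w.1)]
  /- ### the group data: `K_v` compact open, the representation, the Bochner ↔ Hecke bridge -/
  have hKopen : IsOpen (Kv : Set (UnitaryGroup.localPi L (IsCMField.complexConj L) 2 (Matrix.diagonal dV) v)) :=
    UnitaryGroup.isOpen_localInt L (IsCMField.complexConj L) 2 (Matrix.diagonal dV) v
  have hKcpt : IsCompact (Kv : Set (UnitaryGroup.localPi L (IsCMField.complexConj L) 2 (Matrix.diagonal dV) v)) :=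
    UnitaryGroup.isCompact_localInt L (IsCMField.complexConj L) 2 (Matrix.diagonal dV) v
  set ρG : Representation ℂ (UnitaryGroup.localPi L (IsCMField.complexConj L) 2 (Matrix.diagonal dV) v) V :=
    { toFun := fun g => ((τ g : V →L[ℂ] V) : V →ₗ[ℂ] V)
      map_one' := by rw [map_one]; rfl
      map_mul' := fun x y => by rw [map_mul]; rfl } with hρGdef
  have hρG : ∀ g x, ρG g x = τ g x := fun g x => rfl
  have hvK : u ∈ ρG.fixedPoints Kv := by rw [Representation.mem_fixedPoints]; exact heig.1
  have hbridge : ∀ g : UnitaryGroup.localPi L (IsCMField.complexConj L) 2 (Matrix.diagonal dV) v,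
      ∫ x in DoubleCoset.doubleCoset g (Kv : Set _) Kv, τ x u ∂ν = heckeOperator ρG Kv g u := fun g => by
    have h := heckeOperator_apply_eq_integral_holds (V := V) ν Kv hKcpt hKopen ρG g hvK
    rw [hνK, ENNReal.toReal_one, inv_one, one_smul] at h
    exact h.symm
  have hgen₁ : heckeOperator ρG Kv t₁ u = a₁ • u := by
    have h := (heig.2 0).2
    simp only [Matrix.cons_val_zero] at h
    rw [← hbridge]
    exact h
  /- ### the `U(1,1)` Hecke recursion (★ H3a) -/
  obtain ⟨μ, h0, h1, h2μ, hrec⟩ : ∃ μ : ℕ → ℂ, μ 0 = 1 ∧ μ 1 = a₁ ∧ μ 2 = (a₁ - q + 1) * a₁ - (q : ℂ) * (q + 1) ∧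
      ∀ k, μ (k + 3) = (a₁ - q + 1) * μ (k + 2) - (q : ℂ) ^ 2 * μ (k + 1) :=
    ⟨fun m => (Nat.rec ((1 : ℂ), a₁, (a₁ - q + 1) * a₁ - (q : ℂ) * (q + 1))
        (fun _ p => (p.2.1, p.2.2, (a₁ - q + 1) * p.2.2 - (q : ℂ) ^ 2 * p.2.1)) m : ℂ × ℂ × ℂ).1, rfl, rfl, rfl, fun _ => rfl⟩
  have hμ : ∀ m : ℕ, heckeOperator ρG Kv (t₁ ^ m) u = μ m • u := fun m =>
    heckeOperator_pow_apply_eq_smul_inert L dV v w hw hv hϖ hϖσ T hTi hTJ t₁ ht₁ ρG hvK hgen₁ μ h0 h1 h2μ hrec m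
  /- ### the Cartan family `m ↦ t₁ᵐ` (★ p857060) and the spherical eigen-structure -/
  set t : ℕ → UnitaryGroup.localPi L (IsCMField.complexConj L) 2 (Matrix.diagonal dV) v := fun m => t₁ ^ m with htdef
  let f : UnitaryGroup.localPi L (IsCMField.complexConj L) 2 (Matrix.diagonal dV) v →* GL (Fin 2) (w.1.adicCompletion L) :=
    { toFun := fun g => (g : UnitaryGroup.LocalGLPi L 2 v) w
      map_one' := rfl
      map_mul' := fun _ _ => rfl }
  have ht' : ∀ m : ℕ, Units.val ((t m : UnitaryGroup.LocalGLPi L 2 v) w) =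
      ((T⁻¹ : GL (Fin 2) (w.1.adicCompletion L)) : Matrix (Fin 2) (Fin 2) (w.1.adicCompletion L)) *
        Matrix.diagonal ![ϖ ^ m, (ϖ ^ m)⁻¹] * (T : Matrix (Fin 2) (Fin 2) (w.1.adicCompletion L)) := fun m =>
    coe_pow_of_coe_eq_conj_diagonal f T t₁ ht₁ m
  have hCartan : IsCartanFamily Kv t := isCartanFamily_localInt_inert L dV v w hw hv hϖ hϖσ T hTi hTJ t ht'
  have hm : ∀ g : UnitaryGroup.localPi L (IsCMField.complexConj L) 2 (Matrix.diagonal dV) v,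
      MeasurableSet (DoubleCoset.doubleCoset g (Kv : Set _) Kv) := fun g => measurableSet_doubleCoset hKopen g
  have hint0 : ∀ g : UnitaryGroup.localPi L (IsCMField.complexConj L) 2 (Matrix.diagonal dV) v,
      IntegrableOn (fun x => τ x u) (DoubleCoset.doubleCoset g (Kv : Set _) Kv) ν := fun g =>
    (hτc u).continuousOn.integrableOn_compact ((hKcpt.mul isCompact_singleton).mul hKcpt)
  have hSph : IsSphericalHeckeEigen ν Kv t (fun g => τ g) u μ :=
    ⟨heig.1, fun m => ⟨hint0 (t m), by rw [hbridge, hμ]⟩⟩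
  /- ### the kernel `Λ_{s,v} ∘ ι_v(·,1)`: bi-invariance (★ D7d) and values on the family (★ #27i) -/
  have hΛ : ∀ x ∈ Kv,
      ∀ y ∈ Kv,
      ∀ g : UnitaryGroup.localPi L (IsCMField.complexConj L) 2 (Matrix.diagonal dV) v,
        (fun g => LambdaLoc L e dV hdV dW hdW v χ s (iotaLeftLocPi L e dV hdV dW hdW v g)) (x * g * y) =
          (fun g => LambdaLoc L e dV hdV dW hdW v χ s (iotaLeftLocPi L e dV hdV dW hdW v g)) g := fun x hx y hy g => by
    simp only
    rw [lambdaLoc_iotaLeft_mul_localInt L e dV hdV dW hdW v χ s hχ (x * g) hy, lambdaLoc_iotaLeft_localInt_mul L e dV hdV dW hdW v χ s hχ g hx]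
  have hn2 : n = 2 := by have h := Fintype.card_congr e; simpa using h.symm
  set θ : ℂ := χ.valueAtUniformizer w.1 with hθdef
  set Y : ℂ := θ * (q : ℂ) ^ (-(2 * s + 2)) with hYdef
  set Λ' : UnitaryGroup.localPi L (IsCMField.complexConj L) 2 (Matrix.diagonal dV) v → ℂ :=
    fun g => LambdaLoc L e dV hdV dW hdW v χ s (iotaLeftLocPi L e dV hdV dW hdW v g) with hΛ'def
  have hqq : ((q : ℂ) ^ 2) ^ (-(s + 1)) = (q : ℂ) ^ (-(2 * s + 2)) := by
    rw [← Complex.cpow_nat_mul' (x := (q : ℂ)) (n := 2) (by rw [Complex.natCast_arg, mul_zero]; exact neg_lt_zero.2 Real.pi_pos)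
      (by rw [Complex.natCast_arg, mul_zero]; exact Real.pi_pos.le)]
    congr 1; push_cast; ring
  have hΛt : ∀ m : ℕ, Λ' (t m) = Y ^ m := by
    intro m
    have h := lambdaLoc_iotaLeftLocPi_cartan_inert L e dV hdV dW hdW v χ s hχ w hw hϖ hϖσ T hTi hTJ m (t m) (ht' m)
    simp only [hΛ'def]
    rw [h, hn2, show s + ((2 : ℕ) : ℂ) / 2 = s + 1 by push_cast; ring, hnormϖ, ofReal_inv_pow_cpow (pow_pos hqpos 2), Nat.cast_pow, hqq,
      hYdef, mul_pow]
  have hYnorm : ‖Y‖ = (q : ℝ) ^ (-(2 * s.re + 2)) := by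
    rw [hYdef, norm_mul, show ‖χ.valueAtUniformizer w.1‖ = 1 from hχu _, one_mul, Complex.norm_natCast_cpow_of_pos hqpos]
    simp
  /- ### absolute convergence of the doubling Hecke operator on `u`: one geometric cone -/
  set r : ℝ := (q : ℝ) ^ (-(2 * s.re + 2)) with hrdef
  have hr0 : 0 ≤ r := Real.rpow_nonneg (Nat.cast_nonneg q) _
  have hqr : (q : ℝ) * q * r = (q : ℝ) ^ (-(2 * s.re)) := by
    rw [hrdef, show -(2 * s.re + 2) = -(2 * s.re) + (-2 : ℝ) by ring, Real.rpow_add (by positivity),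
      show ((-2 : ℝ)) = ((-2 : ℤ) : ℝ) by norm_num, Real.rpow_intCast, _root_.zpow_neg, zpow_ofNat]
    field_simp
  have hqr1 : (q : ℝ) * q * r < 1 := by
    rw [hqr]
    exact Real.rpow_lt_one_of_one_lt_of_neg hq1r (by linarith)
  haveI : IsHeckeTriple (⊤ : Submonoid (UnitaryGroup.localPi L (IsCMField.complexConj L) 2 (Matrix.diagonal dV) v)) Kv Kv :=
    isHeckeTriple_top_of_isCompact_isOpen Kv hKcpt hKopen
  have hvol : ∀ m : ℕ, (ν (DoubleCoset.doubleCoset (t m) (Kv : Set _) Kv)).toReal ≤ ((q : ℝ) + 1) * q * ((q : ℝ) * q) ^ m := by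
    intro m
    obtain ⟨hfin, hcard⟩ := ncard_orbit_pow_inert L dV v w hw hv hϖ hϖσ T hTi hTJ t₁ ht₁ m
    rw [htdef]
    rw [measure_doubleCoset_eq_ncard_mul _ ν hKopen (t₁ ^ m) hfin, hνK, mul_one, ENNReal.toReal_natCast, hcard]
    split_ifs with hm0
    · subst hm0
      have : (1 : ℝ) ≤ ((q : ℝ) + 1) * q := by nlinarith
      simpa using this
    · obtain ⟨k, rfl⟩ : ∃ k, m = k + 1 := ⟨m - 1, by omega⟩
      rw [Nat.add_sub_cancel]
      push_cast
      have hqq1 : (1 : ℝ) ≤ (q : ℝ) * q := by nlinarith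
      have hpos : (0 : ℝ) ≤ ((q : ℝ) + 1) * q * ((q : ℝ) * q) ^ k := by positivity
      calc ((q : ℝ) + 1) * q * ((q : ℝ) * q) ^ k = ((q : ℝ) + 1) * q * ((q : ℝ) * q) ^ k * 1 := (mul_one _).symm
        _ ≤ ((q : ℝ) + 1) * q * ((q : ℝ) * q) ^ k * ((q : ℝ) * q) := mul_le_mul_of_nonneg_left hqq1 hpos
        _ = ((q : ℝ) + 1) * q * ((q : ℝ) * q) ^ (k + 1) := by rw [pow_succ]; ring
  have hΛnorm : ∀ m : ℕ, ‖Λ' (t m)‖ = r ^ m := fun m => by rw [hΛt m, norm_pow, hYnorm]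
  have hintS : ∀ m : ℕ, IntegrableOn (fun x => Λ' x • τ x u) (DoubleCoset.doubleCoset (t m) (Kv : Set _) Kv) ν := fun m =>
    IntegrableOn.congr_fun (f := fun x => Λ' (t m) • τ x u) ((hint0 (t m)).smul (Λ' (t m)))
      (fun x hx => by simp only [apply_eq_of_mem_doubleCoset hΛ hx]) (hm _)
  have hbnd : ∀ m : ℕ,
      ∫ x in DoubleCoset.doubleCoset (t m) (Kv : Set _) Kv, ‖Λ' x • τ x u‖ ∂ν ≤ ‖u‖ * (((q : ℝ) + 1) * q) * (((q : ℝ) * q) * r) ^ m := by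
    intro m
    have hfinm : ν (DoubleCoset.doubleCoset (t m) (Kv : Set _) Kv) < ⊤ := ((hKcpt.mul isCompact_singleton).mul hKcpt).measure_lt_top
    have hpt : ∀ x ∈ DoubleCoset.doubleCoset (t m) (Kv : Set _) Kv, ‖Λ' x • τ x u‖ ≤ r ^ m * ‖u‖ := by
      intro x hx
      rw [norm_smul, apply_eq_of_mem_doubleCoset hΛ hx, hΛnorm m]
      refine mul_le_mul_of_nonneg_left (((τ x).le_opNorm u).trans ?_) (pow_nonneg hr0 _)
      calc ‖τ x‖ * ‖u‖ ≤ 1 * ‖u‖ := by gcongr; exact hτb x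
        _ = ‖u‖ := one_mul _
    calc ∫ x in DoubleCoset.doubleCoset (t m) (Kv : Set _) Kv, ‖Λ' x • τ x u‖ ∂ν
        ≤ ∫ x in DoubleCoset.doubleCoset (t m) (Kv : Set _) Kv, r ^ m * ‖u‖ ∂ν :=
          setIntegral_mono_on (hintS m).norm (integrableOn_const hfinm.ne) (hm _) hpt
      _ = (ν (DoubleCoset.doubleCoset (t m) (Kv : Set _) Kv)).toReal * (r ^ m * ‖u‖) := by
          rw [setIntegral_const, smul_eq_mul, Measure.real]
      _ ≤ ((q : ℝ) + 1) * q * ((q : ℝ) * q) ^ m * (r ^ m * ‖u‖) :=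
          mul_le_mul_of_nonneg_right (hvol m) (mul_nonneg (pow_nonneg hr0 _) (norm_nonneg u))
      _ = _ := by rw [mul_pow]; ring
  have hsum_bound : Summable fun m : ℕ => ∫ x in DoubleCoset.doubleCoset (t m) (Kv : Set _) Kv, ‖Λ' x • τ x u‖ ∂ν :=
    Summable.of_nonneg_of_le (fun m => integral_nonneg fun x => norm_nonneg _) hbnd
      ((summable_geometric_of_lt_one (by positivity) hqr1).mul_left (‖u‖ * (((q : ℝ) + 1) * q)))
  have hint : DoublingHeckeOpConverges ν Λ' (fun g => τ g) u := by
    have key := integrableOn_iUnion_of_summable_integral_norm (μ := ν) hintS hsum_bound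
    rw [iUnion_doubleCoset_eq_univ hCartan, integrableOn_univ] at key
    exact key
  /- ### the eigen-equation (★ H1) and the closed form (★ p857068) -/
  have hEig := isDoublingHeckeEigenvector_cLoc_of_isOpen ν hKopen hCartan hΛ hSph hint
  refine ⟨cLoc t Λ' μ, hEig, ?_⟩
  have hsum : Summable fun m => Λ' (t m) * μ m := cLocSummable_of_ne_zero ν hCartan (fun m => hm (t m)) hΛ hSph hint hu
  have hs' : Summable fun k => μ k * (θ * (q : ℂ) ^ (-(2 * s + 2))) ^ k :=
    hsum.congr fun m => by rw [hΛt m, hYdef, mul_comm]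
  have hc : cLoc t Λ' μ = ∑' k, μ k * (θ * (q : ℂ) ^ (-(2 * s + 2))) ^ k := by
    rw [cLoc]
    exact tsum_congr fun m => by rw [hΛt m, hYdef, mul_comm]
  exact cartanSeriesU11_closed_form hq0 h0 h1 h2μ hrec hs' hc

end Summit.HodgeConjecture.HodgeConjecture.Cruxes.HLiu418.K2LiuUnramifiedDoublingHeckeIdentityInert

end
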